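import Literature.Probability.RandomPlanarGeometry.SLELawOfDrivingProcess
import Literature.Probability.RandomPlanarGeometry.SLERestrictionLocal
import Literature.Probability.RandomPlanarGeometry.SLETraceApproximation
import Literature.Probability.Process.LevyCharacterisation
import HarnessLib

/-!
# Martingale identification of SLE_κ without the Rohde–Schramm inputs

Topic `Literature/Probability/RandomPlanarGeometry`. Companion of `SLELawOfDrivingProcess.lean`,
whose criterion `isSLELaw_of_isLocalMartingale_driving` — the last step of every convergence
proof by the martingale-observable method (Lawler–Schramm–Werner 2004, §3; Chelkak–Duminil-Copin–
Hongler–Kemppainen–Smirnov 2014, §3: "both coefficients `W_t` and `W_t² - 3t` are martingales …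
Lévy's theorem implies that `W_t = √3 B_t` … for any subsequential limit"; Duminil-Copin–Smirnov
2012, Prop. 6.7) — takes as named-fact inputs Lévy's characterisation, the existence of the
SLE_κ trace (`HasSLETrace κ`, Rohde–Schramm 2005, Thm. 5.1) and the transience of the SLE trace
for *all* `κ` (`tendsto_norm_sleTrace_atTop`, Rohde–Schramm 2005, Thm. 7.1).

This file PROVES that two of these inputs are superfluous and localises the third:

* **`HasSLETrace κ` follows from the hypotheses of the criterion**
  (`hasSLETrace_of_isBrownianReal`, `hasSLETrace_of_isBrownianReal_inv_sqrt_mul`): if on *some*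
  probability space there is a Brownian motion `X` with measurable marginals such that, almost
  surely, the chordal Loewner chain driven by `√κ X` is generated by a curve, then the canonical
  SLE_κ is almost surely generated by a curve. This is the measure-theoretic core of the limit
  argument of Lawler–Schramm–Werner 2004, proof of Thm. 4.7 (p. 981; the tree's
  `hasSLETrace_of_tendstoInDistribution`, `SLETraceApproximation.lean`) and of Kemppainen–Smirnov
  2017, Cor. 1.7 (arXiv Cor. 1.5: "if the driving processes of Loewner chains satisfying
  Condition G converge, also the limiting Loewner chain is generated by a curve"): the set of
  continuous driving paths whose chain is generated by a curve is Borel (Lusin–Souslin,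
  `measurableSet_snd_image_generatedPairs`), it has full measure for the law of `√κ X` on
  `C([0, ∞), ℝ)`, and that law is the law of the SLE_κ driving path (`map_eq_map_drivingPath`,
  after replacing `X` by a modification with everywhere-continuous paths,
  `IsPreBrownianReal.congr`); the junk branches of the canonical space are `hasSLETrace_of_imp`.
* **Lévy's characterisation is a theorem of the tree** (`Process.levy_characterisation_holds`,
  `Process/LevyCharacterisation.lean`).
* **Transience is needed at the single value `κ` only**
  (`isSLELaw_of_isSLEDrivingCoupling_of_ae_tendsto`, `isSLELaw_of_isBrownianReal_driving`,
  `isSLELaw_of_isLocalMartingale_driving_of_ae_tendsto`; the tree's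
  `exists_isSLECurve_through_of_ae_tendsto`), and **for `0 < κ < 4` it is itself a theorem given
  `HasSLETrace κ`** (`tendsto_norm_sleTrace_atTop_of_hasSLETrace_of_lt_four`,
  `SLETransienceLocal.lean`), whence the unconditional criteria
  `isSLELaw_of_isBrownianReal_driving_of_lt_four` and
  `isSLELaw_of_isLocalMartingale_driving_of_lt_four`: **for `κ ∈ (0, 4)` a probability measure on
  curve classes almost surely driven, through a chordal uniformizing map, by a continuous process
  `W` with `W_0 = 0` such that `W/√κ` is a continuous local martingale with `⟨W/√κ⟩_t = t`, IS the
  chordal SLE_κ law — with no named-fact input at all.**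

First consumer: the spin half of crit-ising.S17 (`κ = 3`,
`LatticeModels/InterfaceSLEFrontier.lean`): the identification fact
`isSLELaw_three_of_subseqLimit_spinInterface` (CDHKS 2014, §3) then rests on the single named
fact `exists_drivingMartingales_of_subseqLimit_spinInterface` (CDHKS Thm. 3 and §3). Other
consumers in the range `κ < 4`: loop-erased random walk (`κ = 2`), the self-avoiding walk
conjecture (`κ = 8/3`).

Nothing is redefined; no named fact is introduced.

## Mathlib

USED: `ProbabilityTheory.IsBrownianReal` / `IsPreBrownianReal.congr` (modifications of a
pre-Brownian motion), `exists_measurable_superset_of_null`, `Measurable.ite`, `ae_map_iff`,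
`ae_of_ae_map`, `Measure.map`. From the tree: `hasSLETrace_of_imp`, `map_eq_map_drivingPath`,
`drivingPath`, `generatedPairs`, `measurableSet_snd_image_generatedPairs`
(`SLETraceApproximation.lean`), `Process.measurable_continuousMap_of_eval` (`PathSpaceBorel`),
`exists_isSLECurve_through_of_ae_tendsto` (`SLERestrictionLocal.lean`),
`tendsto_norm_sleTrace_atTop_of_hasSLETrace_of_lt_four` (`SLETransienceLocal.lean`),
`isSLEDrivingCoupling_of_drivingLaw_of_isDrivenBy`, `map_paths_eq_map_brownianPath`,
`Loewner.IsDrivenBy` (`SLELawOfDrivingProcess.lean`), `IsSLEDrivingCoupling`,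
`IsSLECurve.of_through`, `aemeasurable_sleTrace_holds`,
`JordanDomain.continuousOn_boundaryExtension_holds`, `Process.levy_characterisation_holds`.

## References

* G. F. Lawler, O. Schramm, W. Werner, *Conformal invariance of planar loop-erased random walks
  and uniform spanning trees*, Ann. Probab. 32 (2004) 939–995, proof of Thm. 4.7 (p. 981).
* A. Kemppainen, S. Smirnov, *Random curves, scaling limits and Loewner evolutions*, Ann. Probab.
  45 (2017) 698–779, Cor. 1.7 (arXiv:1212.6215v3, Cor. 1.5).
* D. Chelkak, H. Duminil-Copin, C. Hongler, A. Kemppainen, S. Smirnov, *Convergence of Ising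
  interfaces to Schramm's SLE curves*, C. R. Math. Acad. Sci. Paris 352 (2014) 157–161, §3.
* H. Duminil-Copin, S. Smirnov, *Conformal invariance of lattice models*, Clay Math. Proc. 15
  (2012), Prop. 6.7.
* S. Rohde, O. Schramm, *Basic properties of SLE*, Ann. of Math. 161 (2005), Thms 5.1, 7.1.
* G. F. Lawler, *Conformally Invariant Processes in the Plane*, AMS (2005), §6.3.
-/

noncomputable section

open MeasureTheory ProbabilityTheory Filter Topology Set
open UpperHalfPlane (upperHalfPlaneSet)
open scoped NNReal ENNReal

namespace Literature.Probability.RandomPlanarGeometry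

open scoped PathBorel

/-! ### The SLE_κ trace exists as soon as some Brownian motion drives a curve -/

/-- **The SLE_κ trace theorem from any Brownian motion driving a generated chain.** Let `X` be a
Brownian motion (Mathlib `IsBrownianReal`: Brownian finite-dimensional laws, a.s. continuous
paths) with measurable marginals on a probability space `(Ω, Q)`, and suppose that almost surely
the chordal Loewner chain driven by `t ↦ √κ Xₜ` is generated by a curve. Then SLE_κ on the
canonical space is almost surely generated by a curve (`HasSLETrace κ`). Proof: replace `X` by a
modification with everywhere-continuous paths (`IsPreBrownianReal.congr`); the random continuous
path `√κ X ∈ C([0, ∞), ℝ)` then has the law of the SLE_κ driving path (`map_eq_map_drivingPath`)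
and lies almost surely in the Borel (Lusin–Souslin, `measurableSet_snd_image_generatedPairs`) set
of driving paths generated by a curve, which therefore has full measure for the driving path of
the canonical space; the degenerate branches of the canonical space are `hasSLETrace_of_imp`.
This is the measure-theoretic core of Lawler–Schramm–Werner 2004, proof of Thm. 4.7 (p. 981),
and of Kemppainen–Smirnov 2017, Cor. 1.7 ("also the limiting Loewner chain is generated by a
curve"). [cite: LawlerSchrammWerner2004, proof of Thm. 4.7] -/
theorem hasSLETrace_of_isBrownianReal {Ω' : Type*} [MeasurableSpace Ω'] {Q : Measure Ω'}
    {κ : ℝ≥0} {X : ℝ≥0 → Ω' → ℝ} (hBM : IsBrownianReal X Q) (hXm : ∀ t, Measurable (X t))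
    (hgen : ∀ᵐ ω ∂Q, ∃ γ, Loewner.IsGeneratedByCurve (fun t ↦ Real.sqrt κ * X t ω) γ) :
    HasSLETrace κ := by
  classical
  refine hasSLETrace_of_imp fun _ hB ↦ ?_
  -- a modification of `X` with everywhere continuous paths
  obtain ⟨N, hNsub, hNm, hN0⟩ := exists_measurable_superset_of_null (ae_iff.1 hBM.cont)
  have hgood : ∀ ω, ω ∉ N → Continuous (X · ω) := fun ω hω ↦ by
    by_contra h
    exact hω (hNsub h)
  have hae : ∀ᵐ ω ∂Q, ω ∉ N := measure_eq_zero_iff_ae_notMem.1 hN0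
  set B : ℝ≥0 → Ω' → ℝ := fun t ω ↦ if ω ∈ N then 0 else X t ω with hBdef
  have hBc : ∀ ω, Continuous (B · ω) := by
    intro ω
    by_cases hω : ω ∈ N
    · simp only [hBdef, if_pos hω]
      exact continuous_const
    · simp only [hBdef, if_neg hω]
      exact hgood ω hω
  have hBm : ∀ t, Measurable (B t) := fun t ↦ Measurable.ite hNm measurable_const (hXm t)
  have hXB : ∀ t, X t =ᵐ[Q] B t := fun t ↦ by
    filter_upwards [hae] with ω hω
    simp only [hBdef, if_neg hω]
  have hBM' : IsBrownianReal B Q := ⟨hBM.toIsPreBrownianReal.congr hXB, ae_of_all _ hBc⟩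
  -- `√κ B`, as a random continuous path, has the law of the SLE_κ driving path
  set Φ : Ω' → C(ℝ≥0, ℝ) :=
    fun ω ↦ ⟨fun t ↦ Real.sqrt κ * B t ω, continuous_const.mul (hBc ω)⟩ with hΦdef
  have hΦm : Measurable Φ :=
    Process.measurable_continuousMap_of_eval fun t ↦ (hBm t).const_mul _
  have hlaw : Q.map Φ = Process.preWienerMeasure.map (drivingPath κ) :=
    map_eq_map_drivingPath κ hB hBM' hBc hBm
  -- almost surely it lies in the Borel set of driving paths generated by a curve
  have hG : ∀ᵐ ω ∂Q, Φ ω ∈ Prod.snd '' generatedPairs := by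
    filter_upwards [hgen, hae] with ω hω hωN
    obtain ⟨γ, hγ⟩ := hω
    have hΦω : ((Φ ω : C(ℝ≥0, ℝ)) : ℝ≥0 → ℝ) = fun t ↦ Real.sqrt κ * X t ω := by
      funext t
      simp only [hΦdef, ContinuousMap.coe_mk, hBdef, if_neg hωN]
    refine ⟨(⟨γ, hγ.continuous⟩, Φ ω), ?_, rfl⟩
    show Loewner.IsGeneratedByCurve ((Φ ω : C(ℝ≥0, ℝ)) : ℝ≥0 → ℝ) γ
    rw [hΦω]
    exact hγ
  have hG' : ∀ᵐ w ∂Q.map Φ, w ∈ Prod.snd '' generatedPairs :=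
    (ae_map_iff hΦm.aemeasurable measurableSet_snd_image_generatedPairs).2 hG
  rw [hlaw] at hG'
  filter_upwards [ae_of_ae_map (measurable_drivingPath κ).aemeasurable hG'] with ω hω
  obtain ⟨⟨γ, W⟩, hA, hW⟩ := hω
  refine ⟨γ, ?_⟩
  have hW' : (W : ℝ≥0 → ℝ) = sleDriving κ ω := by
    rw [← coe_drivingPath κ ω, ← hW]
  rw [← hW']
  exact hA

/-- **The SLE_κ trace theorem from a process `W` with `W/√κ` Brownian** (`κ > 0`; the format of
the martingale identification, where Lévy's theorem delivers "`W_t/√κ` is a standard Brownian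
motion"): if `W : Ω → ([0, ∞) → ℝ)` has measurable marginals, `t ↦ (√κ)⁻¹ W_t` is a Brownian
motion under `Q` and almost surely the Loewner chain of `W ω` is generated by a curve, then
`HasSLETrace κ` (`hasSLETrace_of_isBrownianReal` with `X = W/√κ`, `√κ X = W`).
(Lawler–Schramm–Werner 2004, proof of Thm. 4.7; Kemppainen–Smirnov 2017, Cor. 1.7.)
[cite: LawlerSchrammWerner2004, proof of Thm. 4.7] -/
theorem hasSLETrace_of_isBrownianReal_inv_sqrt_mul {Ω' : Type*} [MeasurableSpace Ω']
    {Q : Measure Ω'} {κ : ℝ≥0} (hκ : 0 < κ) {W : Ω' → ℝ≥0 → ℝ}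
    (hWm : ∀ t, Measurable fun ω ↦ W ω t)
    (hBM : IsBrownianReal (fun t ω ↦ (Real.sqrt κ)⁻¹ * W ω t) Q)
    (hgen : ∀ᵐ ω ∂Q, ∃ γ, Loewner.IsGeneratedByCurve (W ω) γ) : HasSLETrace κ := by
  have hsqrt : Real.sqrt κ ≠ 0 := (Real.sqrt_pos.2 (by exact_mod_cast hκ)).ne'
  have hWX : ∀ ω, (fun t ↦ Real.sqrt κ * ((Real.sqrt κ)⁻¹ * W ω t)) = W ω := by
    intro ω
    funext t
    rw [← mul_assoc, mul_inv_cancel₀ hsqrt, one_mul]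
  refine hasSLETrace_of_isBrownianReal hBM (fun t ↦ (hWm t).const_mul _) ?_
  filter_upwards [hgen] with ω hω
  simpa only [hWX ω] using hω

/-! ### Identification with transience at the single value `κ` -/

variable {κ : ℝ≥0} {D : DobrushinDomain} {φ : ConformalEquiv upperHalfPlaneSet D.carrier}

/-- **Identification of the SLE_κ law from a Brownian coupling, transience at `κ` only** — as
`isSLELaw_of_isSLEDrivingCoupling` (`SLEDrivingCoupling.lean`), with the transience of the SLE_κ
trace assumed almost surely at the single value `κ` (`htr`) instead of the named fact
`tendsto_norm_sleTrace_atTop` for all `κ`; proof verbatim, through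
`exists_isSLECurve_through_of_ae_tendsto`. (Duminil-Copin–Smirnov 2012, Prop. 6.7, last sentence
of the proof; Lawler 2005, §6.3.) [cite: DuminilCopinSmirnov2012Clay, Prop. 6.7] -/
theorem isSLELaw_of_isSLEDrivingCoupling_of_ae_tendsto (hκt : HasSLETrace κ)
    (htr : ∀ᵐ ω ∂Process.preWienerMeasure, Tendsto (fun t ↦ ‖sleTrace κ ω t‖) atTop atTop)
    (hφ : D.IsChordalUniformizing φ)
    {μ : Measure (CurveClass ℂ)} {ν : Measure (CurveClass ℂ × (ℝ≥0 → ℝ))}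
    (h : IsSLEDrivingCoupling κ D φ μ ν) : IsSLELaw κ D μ := by
  obtain ⟨Γ, hΓm, hΓ⟩ := exists_isSLECurve_through_of_ae_tendsto hκt htr
    JordanDomain.continuousOn_boundaryExtension_holds (aemeasurable_sleTrace_holds hκt) hφ
  -- transport the description of `Γ` along the second projection
  have hΓ' : ∀ᵐ p ∂ν, ∃ c : Curve ℂ, Γ p.2 = CurveClass.mk c ∧
      IsCompactifiedImage φ.boundaryExtension (sleTrace κ p.2) (D.pt 1) c := by
    have h' : ∀ᵐ ω ∂(ν.map Prod.snd), ∃ c : Curve ℂ, Γ ω = CurveClass.mk c ∧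
        IsCompactifiedImage φ.boundaryExtension (sleTrace κ ω) (D.pt 1) c := by
      rw [h.map_snd]
      filter_upwards [hΓ] with ω hω
      exact hω.2
    exact ae_of_ae_map measurable_snd.aemeasurable h'
  -- under `ν`, the curve is `Γ` of the path
  have hae : (Prod.fst : CurveClass ℂ × (ℝ≥0 → ℝ) → CurveClass ℂ) =ᵐ[ν] Γ ∘ Prod.snd := by
    filter_upwards [h.ae_eq_mk_sleTrace, hΓ'] with p hp hp'
    obtain ⟨-, c, hc, hcI⟩ := hp
    obtain ⟨c', hc', hc'I⟩ := hp'
    rw [Function.comp_apply, hc', hc, hcI.unique hc'I]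
  have hΓm' : AEMeasurable Γ (ν.map Prod.snd) := by
    rw [h.map_snd]
    exact hΓm
  refine ⟨Γ, IsSLECurve.of_through hφ hΓm hΓ, ?_⟩
  rw [← h.map_fst, Measure.map_congr hae,
    ← AEMeasurable.map_map_of_aemeasurable hΓm' measurable_snd.aemeasurable, h.map_snd]

/-- **Identification of SLE_κ from a Brownian driving process, transience at `κ` only.** Let
`κ > 0`, let the SLE_κ trace be almost surely transient (`htr`; Rohde–Schramm 2005, Thm. 7.1 at
this `κ` — a theorem of the tree for `κ < 4` given `HasSLETrace κ`), `φ` a chordal uniformizing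
map of `(D; a, b)`, `ν` a probability measure on `CurveClass ℂ` and `W : CurveClass ℂ → ([0, ∞) → ℝ)`
a process on `(CurveClass ℂ, ν)` with measurable marginals such that `t ↦ (√κ)⁻¹ W_t` is a
Brownian motion under `ν` (Mathlib `IsBrownianReal`) and `ν`-a.e. curve class `c` is driven by
`W c` through `φ` (`Loewner.IsDrivenBy`). Then `ν` is the chordal SLE_κ law of `(D; a, b)`. The
existence of the SLE_κ trace is NOT assumed: it follows from the hypotheses
(`hasSLETrace_of_isBrownianReal`). Then: the path law of `W/√κ` is that of the canonical Brownian
path (`map_paths_eq_map_brownianPath`), `isSLEDrivingCoupling_of_drivingLaw_of_isDrivenBy` gives a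
Brownian coupling, and `isSLELaw_of_isSLEDrivingCoupling_of_ae_tendsto` identifies the law.
(CDHKS 2014, §3: "`W_t = √3 B_t` … for any subsequential limit"; Duminil-Copin–Smirnov 2012,
Prop. 6.7.) [cite: CDHKSCRAS2014, §3] -/
theorem isSLELaw_of_isBrownianReal_driving (hκ : 0 < κ)
    (htr : ∀ᵐ ω ∂Process.preWienerMeasure, Tendsto (fun t ↦ ‖sleTrace κ ω t‖) atTop atTop)
    (hφ : D.IsChordalUniformizing φ) {ν : Measure (CurveClass ℂ)} [IsProbabilityMeasure ν]
    {W : CurveClass ℂ → ℝ≥0 → ℝ} (hWm : ∀ t, Measurable fun c ↦ W c t)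
    (hBM : IsBrownianReal (fun t c ↦ (Real.sqrt κ)⁻¹ * W c t) ν)
    (hreg : ∀ᵐ c ∂ν, Loewner.IsDrivenBy φ.boundaryExtension (D.pt 1) (W c) c) :
    IsSLELaw κ D ν := by
  set X : ℝ≥0 → CurveClass ℂ → ℝ := fun t c ↦ (Real.sqrt κ)⁻¹ * W c t with hX
  have hXm : ∀ t, Measurable (X t) := fun t ↦ (hWm t).const_mul _
  have hsqrt : Real.sqrt κ ≠ 0 := (Real.sqrt_pos.2 (by exact_mod_cast hκ)).ne'
  have hWX : ∀ c, (fun t ↦ Real.sqrt κ * X t c) = W c := by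
    intro c
    funext t
    simp only [hX]
    rw [← mul_assoc, mul_inv_cancel₀ hsqrt, one_mul]
  have hκt : HasSLETrace κ := hasSLETrace_of_isBrownianReal_inv_sqrt_mul hκ hWm hBM (by
    filter_upwards [hreg] with c hc
    obtain ⟨γ, hγ, -⟩ := hc
    exact ⟨γ, hγ⟩)
  have hlaw : ν.map (fun c t ↦ X t c) = Process.preWienerMeasure.map brownianPath :=
    map_paths_eq_map_brownianPath hBM.toIsPreBrownianReal hXm
  obtain ⟨νc, hνc⟩ := isSLEDrivingCoupling_of_drivingLaw_of_isDrivenBy (κ := κ) (φ := φ)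
    (fun c t ↦ X t c) (measurable_pi_lambda _ hXm).aemeasurable hlaw (by
      filter_upwards [hBM.cont, hreg] with c hcc hr
      exact ⟨hcc, by rw [hWX c]; exact hr⟩)
  exact isSLELaw_of_isSLEDrivingCoupling_of_ae_tendsto hκt htr hφ hνc

/-- **Martingale identification of chordal SLE_κ, transience at `κ` only** — the criterion
`isSLELaw_of_isLocalMartingale_driving` of `SLELawOfDrivingProcess.lean` with Lévy's
characterisation discharged (`Process.levy_characterisation_holds`), the existence of the SLE_κ
trace derived rather than assumed (`hasSLETrace_of_isBrownianReal`), and the transience of the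
SLE_κ trace assumed almost surely at the single value `κ` (`htr`). Hypotheses otherwise as there:
`W` has measurable marginals, a.s. continuous paths, `W_0 = 0` a.s., `ν`-a.e. `c` is driven by
`W c` through the chordal uniformizing map `φ`, and `X = (√κ)⁻¹ W` is a continuous local
martingale with `⟨X⟩_t = t` for some filtration. (CDHKS 2014, §3, last paragraph; Lawler–Schramm–
Werner 2004, §3; Duminil-Copin–Smirnov 2012, Prop. 6.7.) [cite: CDHKSCRAS2014, §3] -/
theorem isSLELaw_of_isLocalMartingale_driving_of_ae_tendsto (hκ : 0 < κ)
    (htr : ∀ᵐ ω ∂Process.preWienerMeasure, Tendsto (fun t ↦ ‖sleTrace κ ω t‖) atTop atTop)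
    (hφ : D.IsChordalUniformizing φ) {ν : Measure (CurveClass ℂ)} [IsProbabilityMeasure ν]
    {W : CurveClass ℂ → ℝ≥0 → ℝ} (hWm : ∀ t, Measurable fun c ↦ W c t)
    (h0 : ∀ᵐ c ∂ν, W c 0 = 0) (hc : ∀ᵐ c ∂ν, Continuous (W c))
    {𝓕 : Filtration ℝ≥0 (inferInstance : MeasurableSpace (CurveClass ℂ))}
    (hM : IsLocalMartingale (fun t c ↦ (Real.sqrt κ)⁻¹ * W c t) 𝓕 ν)
    (hQ : Process.HasQuadraticVariation (fun t c ↦ (Real.sqrt κ)⁻¹ * W c t) (fun t _ ↦ (t : ℝ)) 𝓕 ν)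
    (hreg : ∀ᵐ c ∂ν, Loewner.IsDrivenBy φ.boundaryExtension (D.pt 1) (W c) c) :
    IsSLELaw κ D ν := by
  have h0' : ∀ᵐ c ∂ν, (Real.sqrt κ)⁻¹ * W c 0 = 0 := by
    filter_upwards [h0] with c hc0
    simp [hc0]
  have hc' : ∀ᵐ c ∂ν, Continuous fun t ↦ (Real.sqrt κ)⁻¹ * W c t := by
    filter_upwards [hc] with c hcc
    exact continuous_const.mul hcc
  have hBM : IsBrownianReal (fun t c ↦ (Real.sqrt κ)⁻¹ * W c t) ν :=
    Process.levy_characterisation_holds hM h0' hc' hQ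
  exact isSLELaw_of_isBrownianReal_driving hκ htr hφ hWm hBM hreg

/-! ### The range `0 < κ < 4`: no Rohde–Schramm input at all -/

/-- **Identification of SLE_κ from a Brownian driving process, `0 < κ < 4`, unconditionally.** In
the range `κ < 4` the transience of the SLE_κ trace is a theorem of the tree given `HasSLETrace κ`
(`tendsto_norm_sleTrace_atTop_of_hasSLETrace_of_lt_four`, Rohde–Schramm 2005, Thm. 7.1 in this
range), and `HasSLETrace κ` follows from the hypotheses (`hasSLETrace_of_isBrownianReal`); so a
probability measure on curve classes almost surely driven through `φ` by a process `W` with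
measurable marginals and `W/√κ` a Brownian motion is the chordal SLE_κ law of `(D; a, b)`, with no
named-fact input. (CDHKS 2014, §3; Duminil-Copin–Smirnov 2012, Prop. 6.7.)
[cite: CDHKSCRAS2014, §3] -/
theorem isSLELaw_of_isBrownianReal_driving_of_lt_four (hκ : 0 < κ) (hκ4 : κ < 4)
    (hφ : D.IsChordalUniformizing φ) {ν : Measure (CurveClass ℂ)} [IsProbabilityMeasure ν]
    {W : CurveClass ℂ → ℝ≥0 → ℝ} (hWm : ∀ t, Measurable fun c ↦ W c t)
    (hBM : IsBrownianReal (fun t c ↦ (Real.sqrt κ)⁻¹ * W c t) ν)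
    (hreg : ∀ᵐ c ∂ν, Loewner.IsDrivenBy φ.boundaryExtension (D.pt 1) (W c) c) :
    IsSLELaw κ D ν := by
  have hκt : HasSLETrace κ := hasSLETrace_of_isBrownianReal_inv_sqrt_mul hκ hWm hBM (by
    filter_upwards [hreg] with c hc
    obtain ⟨γ, hγ, -⟩ := hc
    exact ⟨γ, hγ⟩)
  exact isSLELaw_of_isBrownianReal_driving hκ
    (tendsto_norm_sleTrace_atTop_of_hasSLETrace_of_lt_four hκ hκ4 hκt) hφ hWm hBM hreg

/-- **Martingale identification of chordal SLE_κ for `0 < κ < 4`, unconditionally** (the last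
paragraph of CDHKS 2014, §3, for `κ = 3`; also `κ = 2`, `8/3`): let `ν` be a probability measure on
`CurveClass ℂ`, `φ` a chordal uniformizing map of `(D; a, b)` and `W : CurveClass ℂ → ([0, ∞) → ℝ)`
a process with measurable marginals, a.s. continuous paths and `W_0 = 0` a.s., such that
`ν`-a.e. `c` is driven by `W c` through `φ` and `(√κ)⁻¹ W` is a continuous local martingale with
quadratic variation `t` for some filtration. Then `ν` is the chordal SLE_κ law of `(D; a, b)`.
Lévy's characterisation (`Process.levy_characterisation_holds`), the existence of the SLE_κ
trace (`hasSLETrace_of_isBrownianReal`) and its transience for `κ < 4`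
(`tendsto_norm_sleTrace_atTop_of_hasSLETrace_of_lt_four`) are theorems, so no named fact enters.
[cite: CDHKSCRAS2014, §3] -/
theorem isSLELaw_of_isLocalMartingale_driving_of_lt_four (hκ : 0 < κ) (hκ4 : κ < 4)
    (hφ : D.IsChordalUniformizing φ) {ν : Measure (CurveClass ℂ)} [IsProbabilityMeasure ν]
    {W : CurveClass ℂ → ℝ≥0 → ℝ} (hWm : ∀ t, Measurable fun c ↦ W c t)
    (h0 : ∀ᵐ c ∂ν, W c 0 = 0) (hc : ∀ᵐ c ∂ν, Continuous (W c))
    {𝓕 : Filtration ℝ≥0 (inferInstance : MeasurableSpace (CurveClass ℂ))}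
    (hM : IsLocalMartingale (fun t c ↦ (Real.sqrt κ)⁻¹ * W c t) 𝓕 ν)
    (hQ : Process.HasQuadraticVariation (fun t c ↦ (Real.sqrt κ)⁻¹ * W c t) (fun t _ ↦ (t : ℝ)) 𝓕 ν)
    (hreg : ∀ᵐ c ∂ν, Loewner.IsDrivenBy φ.boundaryExtension (D.pt 1) (W c) c) :
    IsSLELaw κ D ν := by
  have h0' : ∀ᵐ c ∂ν, (Real.sqrt κ)⁻¹ * W c 0 = 0 := by
    filter_upwards [h0] with c hc0
    simp [hc0]
  have hc' : ∀ᵐ c ∂ν, Continuous fun t ↦ (Real.sqrt κ)⁻¹ * W c t := by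
    filter_upwards [hc] with c hcc
    exact continuous_const.mul hcc
  have hBM : IsBrownianReal (fun t c ↦ (Real.sqrt κ)⁻¹ * W c t) ν :=
    Process.levy_characterisation_holds hM h0' hc' hQ
  exact isSLELaw_of_isBrownianReal_driving_of_lt_four hκ hκ4 hφ hWm hBM hreg

end Literature.Probability.RandomPlanarGeometry
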